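import Summits.NavierStokesRegularity.NavierStokesRegularity.Theses.AxisymmetricExtremality
import Summits.NavierStokesRegularity.NavierStokesRegularity.Theorems.AxisymmetricExtremalityAxisymmetricKatoGlobalNoSwirlStratum

/-!
# Strategist census s19-g8 (family `s`, independent) — typed attempts for crux `AxisymmetricKatoGlobal`
# (stmt-NavierStokesRegularity-15453, route `AxisymmetricExtremality`)

Companion of `Cruxes/AxisymmetricKatoGlobal/STRATEGY-CENSUS-s19.md` (gen 8). Everything here is
sorry-free; nothing restates or weakens the crux. Contents:

* § 1 `NoAxisymMinimalDatum` (W1, the THRESHOLD instance of the crux) — `closes` consumes only W1: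
  `closes_of_noAxisymMinimalDatum : MinimalDatumPFold → PFoldToAxisymmetric → W1 → NavierStokesRegularity`
  (same pure logic as the route's `closes`), and `noAxisymMinimalDatum_of_crux : AX_H → W1`.
* § 2 O(2)-symmetry kills the swirl: `hasNoSwirl_of_isReflectionSymmetric` (equivariance under the
  vertical reflections ⇒ `HasNoSwirl`), hence with the LANDED no-swirl stratum
  (`Theorems.AxisymmetricKatoGlobal.NoSwirlStratum.hasGlobalKatoSolution_of_isAxisymmetric_hasNoSwirl_viscosity`)
  `noO2MinimalDatum`: there is NO O(2)-symmetric Rusin–Šverák minimal blow-up datum, at any `ν > 0` — PROVED.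
* § 3 the AX_H-free re-gluing this suggests for the ROUTE (not a line on the crux): items
  `MinimalDatumDihedral` (Smith for 2-groups: dihedral `D_p`-symmetric minimal data) and `DihedralToO2`
  (compactness upgrade, analogue of the PROVED `PFoldToAxisymmetric`), with the kernel-checked
  `closes_bypass : MinimalDatumDihedral → DihedralToO2 → NavierStokesRegularity` — AX_H is not a hypothesis.
* § 4 Strengthen: the continuity-method form `AxisymGoodRadiusOpen` (good radii are open) is
  EQUIVALENT to the crux over Mathlib alone (`axisymGoodRadiusOpen_iff_crux`) — the "induction on the
  critical norm" has no step short of the crux itself.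

References: W. Rusin, V. Šverák, arXiv:0911.0500 [RusinSverak2011]; C. Allday, V. Puppe, CUP 1993,
(1.3.7) p. 39-40 (book pages), §3.10 [AlldayPuppe1993]; KNSS 2009 arXiv:0709.3599 [KNSS2009].
-/

set_option linter.dupNamespace false
set_option linter.unusedVariables false

noncomputable section

open MeasureTheory WithLp
open scoped ENNReal
open Literature.Analysis.FluidPDE Literature.Analysis.FunctionSpaces
open Literature.Analysis.FunctionSpaces.EuclideanSpace (complexify)
open Summit.NavierStokesRegularity.NavierStokesRegularity.Theses.AxisymmetricExtremality

namespace Summit.NavierStokesRegularity.NavierStokesRegularity.Cruxes.AxisymmetricKatoGlobal.StrategistS19g8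

local notation "ℝ³" => EuclideanSpace ℝ (Fin 3)
local notation "ℂ³" => EuclideanSpace ℂ (Fin 3)

/-! ## § 1 The threshold instance W1 is all that `closes` consumes -/

/-- **W1.** No axisymmetric Rusin–Šverák minimal blow-up datum, at any viscosity (axisymmetry as
`IsAxisymmetric`, definitionally the crux's written-out clause). [folklore] -/
def NoAxisymMinimalDatum : Prop :=
  ∀ ν : ℝ, 0 < ν → ∀ (u₀ : ℝ³ → ℝ³) (g : HomSobolev ℝ³ ℂ³ (1 / 2 : ℝ)),
    IsMinimalBlowupDatum ν u₀ g → IsAxisymmetric u₀ → False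

/-- The crux implies its threshold instance. [folklore] -/
theorem noAxisymMinimalDatum_of_crux (h : AxisymmetricKatoGlobal) : NoAxisymMinimalDatum := by
  intro ν hν u₀ g hmin hax
  obtain ⟨hL3, hrep, hdiv, -, hnot⟩ := hmin
  exact hnot (h ν hν u₀ g hL3 hrep hdiv hax)

/-- `closes` with W1 in place of AX_H — the same pure logic as the route's deciding theorem; so the
route needs the crux only at the threshold `‖g‖ = ρ_max^pure(ν)`. [folklore] -/
theorem closes_of_noAxisymMinimalDatum (h₂ : MinimalDatumPFold) (h₄ : PFoldToAxisymmetric)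
    (h₃ : NoAxisymMinimalDatum) : NavierStokesRegularity := by
  show Literature.NS.NavierStokesExistenceSmoothR3
  intro ν hν u₀ hsm hdiv hdec
  by_contra hno
  obtain ⟨u₁, g, hmin, hax⟩ := h₄ ν hν (h₂ ν hν ⟨u₀, hsm, hdiv, hdec, hno⟩)
  exact h₃ ν hν u₁ g hmin hax

/-! ## § 2 O(2)-symmetry kills the swirl -/

/-- The reflection of `ℝ³` across the vertical plane through the `x 2`-axis at angle `φ` to `e₀`,
parametrised by `(c, s) = (cos 2φ, sin 2φ)`: `(x₀, x₁, x₂) ↦ (c x₀ + s x₁, s x₀ − c x₁, x₂)`.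
With `(c, s) = (1, 0)` it is `σ : (x₀, x₁, x₂) ↦ (x₀, −x₁, x₂)`. [folklore] -/
def reflZ (c s : ℝ) (x : ℝ³) : ℝ³ :=
  toLp 2 ![c * x 0 + s * x 1, s * x 0 - c * x 1, x 2]

@[simp] theorem reflZ_apply_zero (c s : ℝ) (x : ℝ³) : reflZ c s x 0 = c * x 0 + s * x 1 := rfl
@[simp] theorem reflZ_apply_one (c s : ℝ) (x : ℝ³) : reflZ c s x 1 = s * x 0 - c * x 1 := rfl
@[simp] theorem reflZ_apply_two (c s : ℝ) (x : ℝ³) : reflZ c s x 2 = x 2 := rfl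

/-- Equivariance under every vertical reflection (the reflection half of `O(2) ⊂ O(3)`; together with
`IsAxisymmetric` this is full `O(2)`-symmetry about the `x 2`-axis). [folklore] -/
def IsReflectionSymmetric (u : ℝ³ → ℝ³) : Prop :=
  ∀ c s : ℝ, c ^ 2 + s ^ 2 = 1 → ∀ x, u (reflZ c s x) = reflZ c s (u x)

/-- **Reflection symmetry kills the swirl**: at `x` off the axis use the reflection fixing `x`
(`c = (x₀² − x₁²)/r²`, `s = 2x₀x₁/r²`); `u x` is then fixed by it, i.e. lies in the meridional
plane, so `Γ(x) = x₀u₁ − x₁u₀ = 0`. [folklore] -/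
theorem hasNoSwirl_of_isReflectionSymmetric {u : ℝ³ → ℝ³} (h : IsReflectionSymmetric u) :
    HasNoSwirl u := by
  intro x
  unfold swirl
  by_cases hr : x 0 ^ 2 + x 1 ^ 2 = 0
  · have h0 : x 0 = 0 := by nlinarith [sq_nonneg (x 0), sq_nonneg (x 1)]
    have h1 : x 1 = 0 := by nlinarith [sq_nonneg (x 0), sq_nonneg (x 1)]
    rw [h0, h1]; ring
  · obtain ⟨c, e1⟩ : ∃ c : ℝ, c * (x 0 ^ 2 + x 1 ^ 2) = x 0 ^ 2 - x 1 ^ 2 :=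
      ⟨(x 0 ^ 2 - x 1 ^ 2) / (x 0 ^ 2 + x 1 ^ 2), by field_simp⟩
    obtain ⟨s, e2⟩ : ∃ s : ℝ, s * (x 0 ^ 2 + x 1 ^ 2) = 2 * x 0 * x 1 :=
      ⟨(2 * x 0 * x 1) / (x 0 ^ 2 + x 1 ^ 2), by field_simp⟩
    have hcs : c ^ 2 + s ^ 2 = 1 := by
      have key : (c ^ 2 + s ^ 2) * (x 0 ^ 2 + x 1 ^ 2) ^ 2 = 1 * (x 0 ^ 2 + x 1 ^ 2) ^ 2 := by
        linear_combination (c * (x 0 ^ 2 + x 1 ^ 2) + (x 0 ^ 2 - x 1 ^ 2)) * e1 +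
          (s * (x 0 ^ 2 + x 1 ^ 2) + 2 * x 0 * x 1) * e2
      exact mul_right_cancel₀ (pow_ne_zero 2 hr) key
    have hfix : reflZ c s x = x := by
      ext i
      fin_cases i
      · show c * x 0 + s * x 1 = x 0
        have key : (c * x 0 + s * x 1) * (x 0 ^ 2 + x 1 ^ 2) = x 0 * (x 0 ^ 2 + x 1 ^ 2) := by
          linear_combination (x 0) * e1 + (x 1) * e2
        exact mul_right_cancel₀ hr key
      · show s * x 0 - c * x 1 = x 1
        have key : (s * x 0 - c * x 1) * (x 0 ^ 2 + x 1 ^ 2) = x 1 * (x 0 ^ 2 + x 1 ^ 2) := by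
          linear_combination (x 0) * e2 - (x 1) * e1
        exact mul_right_cancel₀ hr key
      · rfl
    have hu : u x = reflZ c s (u x) := by
      have := h c s hcs x
      rwa [hfix] at this
    have E0 : u x 0 = c * u x 0 + s * u x 1 := congrArg (fun v : ℝ³ => v 0) hu
    have E1 : u x 1 = s * u x 0 - c * u x 1 := congrArg (fun v : ℝ³ => v 1) hu
    have k1 : x 0 * (x 0 * u x 1 - x 1 * u x 0) = 0 := by
      linear_combination ((x 0 ^ 2 + x 1 ^ 2) / 2) * E1 - (u x 1 / 2) * e1 + (u x 0 / 2) * e2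
    have k0 : x 1 * (x 0 * u x 1 - x 1 * u x 0) = 0 := by
      linear_combination (-(x 0 ^ 2 + x 1 ^ 2) / 2) * E0 - (u x 0 / 2) * e1 - (u x 1 / 2) * e2
    have hsum : (x 0 ^ 2 + x 1 ^ 2) * (x 0 * u x 1 - x 1 * u x 0) = 0 := by
      linear_combination (x 0) * k1 + (x 1) * k0
    exact (mul_eq_zero.1 hsum).resolve_left hr

/-- O(2)-symmetric (axisymmetric and reflection-symmetric) weakly divergence-free `L³` data have
global Kato solutions at every viscosity — the LANDED no-swirl stratum applied through
`hasNoSwirl_of_isReflectionSymmetric`. [cite: KNSS2009, Thm 5.2; Ladyzhenskaya1968; UkhovskiiYudovich1968] -/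
theorem hasGlobalKatoSolution_of_O2 {ν : ℝ} (hν : 0 < ν) {u₀ : ℝ³ → ℝ³}
    (hu₀ : MemLp u₀ 3 volume) (hdiv : IsWeaklyDivFree u₀) (hax : IsAxisymmetric u₀)
    (hrefl : IsReflectionSymmetric u₀) : HasGlobalKatoSolution ν u₀ :=
  Theorems.AxisymmetricKatoGlobal.NoSwirlStratum.hasGlobalKatoSolution_of_isAxisymmetric_hasNoSwirl_viscosity
    hν hu₀ hdiv hax (hasNoSwirl_of_isReflectionSymmetric hrefl)

/-- **No O(2)-symmetric minimal blow-up datum** (any `ν > 0`): the fixed locus of the meridional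
reflection `σ` on the axisymmetric stratum of the Rusin–Šverák moduli space is EMPTY. PROVED. [folklore] -/
theorem noO2MinimalDatum (ν : ℝ) (hν : 0 < ν) (u₀ : ℝ³ → ℝ³) (g : HomSobolev ℝ³ ℂ³ (1 / 2 : ℝ))
    (hmin : IsMinimalBlowupDatum ν u₀ g) (hax : IsAxisymmetric u₀) (hrefl : IsReflectionSymmetric u₀) :
    False := by
  obtain ⟨hL3, -, hdiv, -, hnot⟩ := hmin
  exact hnot (hasGlobalKatoSolution_of_O2 hν hL3 hdiv hax hrefl)

/-! ## § 3 The AX_H-free re-gluing (route-level finding; NOT a line on this crux) -/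

/-- **B1 `MinimalDatumDihedral`** (the sister crux re-typed for 2-GROUPS): Clay failure at `ν` ⇒ for
unboundedly many `p ≥ 2` a Rusin–Šverák minimal blow-up datum equivariant under the rotation
`R_{2π/p}` AND under the reflection `σ = reflZ 1 0`, i.e. under the dihedral group `D_p ⊂ O(2) ⊂ O(3)`
(Navier–Stokes is `O(3)`-equivariant, `u ↦ σ ∘ u ∘ σ`, so `D_p` acts on `M̂(ν) = M(ν)/Sim`; the Smith
input is `F_2`-acyclicity of `M̂(ν)` used for the 2-groups `D_{2^k}`). [cite: AlldayPuppe1993, (1.3.7) and §3.10; RusinSverak2011, Cor 4.3] -/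
def MinimalDatumDihedral : Prop :=
  ∀ ν : ℝ, 0 < ν → (∃ v₀ : ℝ³ → ℝ³, ContDiff ℝ (⊤ : ℕ∞) v₀ ∧ NSWave0.IsDivFree v₀ ∧
      HasRapidSpatialDecay v₀ ∧ ¬ ∃ (u : ℝ → ℝ³ → ℝ³) (p : ℝ → ℝ³ → ℝ), IsSmoothOnHalfSpace u ∧
        IsSmoothOnHalfSpace p ∧ IsNavierStokesSolution ν 0 v₀ u p ∧ HasBoundedEnergy u) →
    ∀ N : ℕ, ∃ p : ℕ, N ≤ p ∧ 2 ≤ p ∧ ∃ (u₀ : ℝ³ → ℝ³) (g : HomSobolev ℝ³ ℂ³ (1 / 2 : ℝ)),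
      IsMinimalBlowupDatum ν u₀ g ∧ (∀ x, u₀ (rotZ (2 * Real.pi / p) x) = rotZ (2 * Real.pi / p) (u₀ x)) ∧
        ∀ x, u₀ (reflZ 1 0 x) = reflZ 1 0 (u₀ x)

/-- **B2 `DihedralToO2`** (compactness upgrade, the analogue of the PROVED `PFoldToAxisymmetric`): dihedral
minimal data for unboundedly many `p` ⇒ an `O(2)`-symmetric minimal datum (axis pinning + dense angles as in
`axisymmetricExtremality_pFoldToAxisymmetric_proof`, plus closedness of the reflection condition under
modulated `L³`-limits). [cite: RusinSverak2011, Thm 4.2] -/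
def DihedralToO2 : Prop :=
  ∀ ν : ℝ, 0 < ν → (∀ N : ℕ, ∃ p : ℕ, N ≤ p ∧ 2 ≤ p ∧ ∃ (u₀ : ℝ³ → ℝ³) (g : HomSobolev ℝ³ ℂ³ (1 / 2 : ℝ)),
      IsMinimalBlowupDatum ν u₀ g ∧ (∀ x, u₀ (rotZ (2 * Real.pi / p) x) = rotZ (2 * Real.pi / p) (u₀ x)) ∧
        ∀ x, u₀ (reflZ 1 0 x) = reflZ 1 0 (u₀ x)) →
    ∃ (u₀ : ℝ³ → ℝ³) (g : HomSobolev ℝ³ ℂ³ (1 / 2 : ℝ)),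
      IsMinimalBlowupDatum ν u₀ g ∧ IsAxisymmetric u₀ ∧ IsReflectionSymmetric u₀

/-- **The AX_H-free deciding theorem** (kernel-checked): `B1 → B2 → Clay (A)`, with `noO2MinimalDatum` in the
slot where the route's `closes` uses AX_H. [folklore] -/
theorem closes_bypass (hB1 : MinimalDatumDihedral) (hB2 : DihedralToO2) : NavierStokesRegularity := by
  show Literature.NS.NavierStokesExistenceSmoothR3
  intro ν hν u₀ hsm hdiv hdec
  by_contra hno
  obtain ⟨u₁, g, hmin, hax, hrefl⟩ := hB2 ν hν (hB1 ν hν ⟨u₀, hsm, hdiv, hdec, hno⟩)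
  exact noO2MinimalDatum ν hν u₁ g hmin hax hrefl

/-! ## § 4 Strengthen: the continuity-method form is equivalent to the crux -/

/-- **S⁺ `AxisymGoodRadiusOpen`**: at every `ν > 0` the set of GOOD RADII (`ρ` such that every admissible
axisymmetric datum of `Ḣ^{1/2}`-norm `< ρ` has a global Kato solution) is open upwards: a finite good radius
can be enlarged. This is the "induction on the critical norm" (Kenig–Merle / continuity method) shape. [folklore] -/
def AxisymGoodRadiusOpen : Prop :=
  ∀ ν : ℝ, 0 < ν → ∀ ρ : ℝ≥0∞, ρ < ⊤ →
    (∀ (u₀ : ℝ³ → ℝ³) (g : HomSobolev ℝ³ ℂ³ (1 / 2 : ℝ)), MemLp u₀ 3 volume →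
        g.Represents (complexify ∘ u₀) → IsWeaklyDivFree u₀ → IsAxisymmetric u₀ → ‖g‖ₑ < ρ →
          HasGlobalKatoSolution ν u₀) →
      ∃ ε : ℝ≥0∞, 0 < ε ∧ ∀ (u₀ : ℝ³ → ℝ³) (g : HomSobolev ℝ³ ℂ³ (1 / 2 : ℝ)), MemLp u₀ 3 volume →
        g.Represents (complexify ∘ u₀) → IsWeaklyDivFree u₀ → IsAxisymmetric u₀ → ‖g‖ₑ < ρ + ε →
          HasGlobalKatoSolution ν u₀

/-- **S⁺ ⟺ crux** over Mathlib alone: (→) by the supremum of the good radii (`0` is good; if the supremum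
were finite it would be good by `lt_sSup_iff` and then enlargeable — contradiction; so it is `⊤` and every
datum lies below a good radius); (←) trivially with `ε = 1`. So the continuity method's inductive step IS the
crux at the threshold; no leverage. [folklore] -/
theorem axisymGoodRadiusOpen_iff_crux : AxisymGoodRadiusOpen ↔ AxisymmetricKatoGlobal := by
  constructor
  · intro h ν hν u₀ g hL3 hrep hdiv hax
    let G : Set ℝ≥0∞ := {ρ | ∀ (v : ℝ³ → ℝ³) (k : HomSobolev ℝ³ ℂ³ (1 / 2 : ℝ)), MemLp v 3 volume →
      k.Represents (complexify ∘ v) → IsWeaklyDivFree v → IsAxisymmetric v → ‖k‖ₑ < ρ →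
        HasGlobalKatoSolution ν v}
    have htop : sSup G = ⊤ := by
      by_contra hne
      have hlt : sSup G < ⊤ := lt_top_iff_ne_top.2 hne
      have hmem : sSup G ∈ G := by
        intro v k hv1 hv2 hv3 hv4 hvlt
        obtain ⟨ρ, hρG, hvρ⟩ := lt_sSup_iff.1 hvlt
        exact hρG v k hv1 hv2 hv3 hv4 hvρ
      obtain ⟨ε, hε, hstep⟩ := h ν hν (sSup G) hlt hmem
      have hin : sSup G + ε ∈ G := hstep
      have hle : sSup G + ε ≤ sSup G := le_sSup hin
      exact absurd hle (not_le.2 (ENNReal.lt_add_right hne hε.ne'))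
    have hfin : ‖g‖ₑ < sSup G := by
      rw [htop]
      exact enorm_lt_top
    obtain ⟨ρ, hρG, hgρ⟩ := lt_sSup_iff.1 hfin
    exact hρG u₀ g hL3 hrep hdiv hax hgρ
  · intro h ν hν ρ hρ hgood
    exact ⟨1, one_pos, fun u₀ g hL3 hrep hdiv hax _ => h ν hν u₀ g hL3 hrep hdiv hax⟩

end Summit.NavierStokesRegularity.NavierStokesRegularity.Cruxes.AxisymmetricKatoGlobal.StrategistS19g8
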